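import Summits.AtomisticToContinuum.FouriersLaw.Theorems.BondHeatUncertaintyLinearResponseFTURLineComposition
import Summits.AtomisticToContinuum.FouriersLaw.Theorems.BondHeatUncertaintyLinearResponseFTURPathLebesgueDuality
import Summits.AtomisticToContinuum.FouriersLaw.Theorems.BondHeatUncertaintyLinearResponseFTURK3Final
import Summits.AtomisticToContinuum.FouriersLaw.Theorems.BondHeatUncertaintyLinearResponseFTUREntropyBalance
import Summits.AtomisticToContinuum.FouriersLaw.Theorems.BondHeatUncertaintyLinearResponseFTURSteadyHeatRates
import Summits.AtomisticToContinuum.FouriersLaw.Theorems.BondHeatUncertaintyLinearResponseFTUREquilibriumBondHeatVariance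
import Summits.AtomisticToContinuum.FouriersLaw.Theorems.BondHeatUncertaintyLinearResponseFTURBondHeatVarianceContinuity
import Summits.AtomisticToContinuum.FouriersLaw.Theorems.BondHeatUncertaintyLinearResponseFTURFiniteBiasClausius

/-!
# Crux ★ `BondHeatUncertainty.LinearResponseFTUR` — closed by line `lebesgue-flip-duality`

Closes the crux item stmt-AtomisticToContinuum-9122 of route `BondHeatUncertainty` (sub `FouriersLaw`):
the composition `Line.lineComposition` applied to the seven landed stubs
(`stub_pathLebesgueDuality`, `stub_antiDampedGirsanov`, `stub_entropyBalance`, `stub_steadyHeatRates`,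
`stub_equilibriumBondHeatVariance`, `stub_bondHeatVarianceContinuity`, `stub_finiteBiasClausius`).
-/

namespace Summit.AtomisticToContinuum.FouriersLaw.Theorems

/-- **★ `LinearResponseFTUR` holds** (line `lebesgue-flip-duality`: path-level Lebesgue duality + the
anti-damped Girsanov formula ⇒ heat-flux detailed balance ⇒ entropy balance, Clausius, FTUR transfer). -/
theorem LinearResponseFTUR_of :
    Summit.AtomisticToContinuum.FouriersLaw.Theses.BondHeatUncertainty.LinearResponseFTUR :=
  LinearResponseFTUR.Line.lineComposition Summit.AtomisticToContinuum.FouriersLaw.Theorems.LinearResponseFTUR.stub_pathLebesgueDuality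
    Summit.AtomisticToContinuum.FouriersLaw.Theorems.LinearResponseFTUR.stub_antiDampedGirsanov Summit.AtomisticToContinuum.FouriersLaw.Theorems.LinearResponseFTUR.stub_entropyBalance
    Summit.AtomisticToContinuum.FouriersLaw.Theorems.LinearResponseFTUR.stub_steadyHeatRates Summit.AtomisticToContinuum.FouriersLaw.Theorems.LinearResponseFTUR.stub_equilibriumBondHeatVariance
    Summit.AtomisticToContinuum.FouriersLaw.Theorems.LinearResponseFTUR.stub_bondHeatVarianceContinuity Summit.AtomisticToContinuum.FouriersLaw.Theorems.LinearResponseFTUR.stub_finiteBiasClausius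

/-- The crux, under the gate's naming convention. -/
theorem LinearResponseFTUR_proof :
    Summit.AtomisticToContinuum.FouriersLaw.Theses.BondHeatUncertainty.LinearResponseFTUR :=
  LinearResponseFTUR_of

end Summit.AtomisticToContinuum.FouriersLaw.Theorems
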